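import Mathlib
import HarnessLib

/-!
# Bergeron–Millson–Moeglin (2016), §3.2: the cohomological representations `A_𝔮` of `U(p,q)` —
# characterisation by the `K`-type `V(𝔮)`, dependence on `𝔲 ∩ 𝔭`, cohomology — as a typed dictionary

Reproduction (typed skeleton, DICTIONARY LEVEL) of: N. Bergeron, J. Millson, C. Moeglin, *The Hodge
conjecture and arithmetic quotients of complex balls*, Acta Math. **216** (2016) 1–125, §3.2
"Cohomological representations", pp. 13–14, display (3.1) [BergeronMillsonMoeglin2016Balls]
(= §2.2 of arXiv:1306.1515, held text `paper:arxiv-1306.1515` chunk p0010, verbatim below; the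
JOURNAL differs from the arXiv draft in three places, recorded in brackets).  Setting (§3.1 p. 13):
"`G = U(V) ≅ U(p,q)` and `K ≅ U(p) × U(q)`".

Verbatim (arXiv chunk p0010 L13–L50): "A unitary representation `π` of `G` is cohomological if it
has nonzero `(𝔤, K)`-cohomology `H^•(𝔤, K; V_π)`.  Cohomological representations are classified by
Vogan and Zuckerman in [VZ]: let `𝔱₀` be a Cartan subalgebra of `𝔨₀`. A `θ`-stable parabolic
subalgebra `𝔮 = 𝔮(X) ⊂ 𝔤` is associated to an element `X ∈ i𝔱₀`. It is defined as the direct sum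
`𝔮 = 𝔩 ⊕ 𝔲`, of the centralizer `𝔩` of `X` and the sum `𝔲` of the positive eigenspaces of `ad(X)`.
… Let `R = dim(𝔲 ∩ 𝔭)`.  Associated to `𝔮`, there is a well-defined, irreducible essentially unitary
[journal: unitary] representation `A_𝔮` of `G`; it is characterized by the following properties. …
Let `e(𝔮)` be a generator of the line `∧^R(𝔲 ∩ 𝔭)`; we shall refer to such a vector as a
Vogan-Zuckerman vector. Then `e(𝔮)` is the highest weight vector of an irreducible representation
`V(𝔮)` of `K` contained in `∧^R 𝔭` (and whose highest weight is thus necessarily `2ρ(𝔲 ∩ 𝔭)`). The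
representation `A_𝔮` is then uniquely characterized by the following two properties: `A_𝔮` is
essentially unitary [journal (3.1): "(1) `A_𝔮` is unitary"] with trivial central character and with
the same infinitesimal character as the trivial representation, `Hom_K(V(𝔮), A_𝔮) ≠ 0`.  Note that
(the equivalence class of) `A_𝔮` only depends on the intersection `𝔲 ∩ 𝔭` so that two parabolic
subalgebras `𝔮 = 𝔩 ⊕ 𝔲` and `𝔮' = 𝔩' ⊕ 𝔲'` which satisfy `𝔲 ∩ 𝔭 = 𝔲' ∩ 𝔭'` yield the same
(equivalent class of) cohomological representation. Moreover `V(𝔮)` occurs with multiplicity one in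
`A_𝔮` and `∧^R 𝔭`, and `H^•(𝔤, K; A_𝔮) ≅ Hom_{L∩K}(∧^{•−R}(𝔩 ∩ 𝔨), ℂ)` [sic; Vogan–Zuckerman
Thm 5.5 / Borel–Wallach VI 5.3: `H^{•−R}(𝔩, 𝔩 ∩ 𝔨; ℂ) = Hom_{L∩K}(∧^{•−R}(𝔩 ∩ 𝔭), ℂ)`]. Here `L`
is a subgroup of `K` with Lie algebra `𝔩` [journal: "`L` is the connected subgroup of `G` with
complexified Lie algebra `𝔩`"]."

## Transcription level

As in `Literature.RepresentationTheory.VoganZuckerman1984.VoganZuckermanData` (the general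
statement) and `Literature.RepresentationTheory.BorelWallach2000.SUn1Table`: a predicate on an
explicit dictionary `UpqCohomological` (irreducible admissible representations of `U(p,q)` up to
equivalence, the `θ`-stable parabolics `𝔮(X)`, the datum `𝔲 ∩ 𝔭`, `R`, the `K`-types, `V(𝔮)`,
`dim Hom_K(τ, V)`, `A_𝔮`, `dim H^k(𝔤,K;V)`, the printed right-hand side `dim Hom_{L∩K}(∧^j(…), ℂ)`).
NOTHING IS ASSERTED; the tree has no `U(p,q)` as a real group with its `(𝔤,K)`-modules yet
(`Literature.NumberTheory.Automorphic.UnitaryGroup.*` is adelic; `LDSDatum p q` is parameters only).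

NOT here: BMM's use of the `A_𝔮` (§§5–8: theta lifts, Arthur parameters), the combinatorics of
`𝔮(X)` for `𝔲(p,q)` as pairs of ordered partitions, the Hodge bidegrees `(R⁺, R⁻)` (see
`VoganZuckermanData.HodgeTypeVanishing`).

## References

* N. Bergeron, J. Millson, C. Moeglin, Acta Math. 216 (2016) 1–125, §3.1–3.2 pp. 13–14, (3.1);
  arXiv:1306.1515 §2.2. [BergeronMillsonMoeglin2016Balls]
* D. A. Vogan Jr., G. J. Zuckerman, Compositio Math. 53 (1984), Thm 5.5, Thm 5.6 (the source of
  the classification BMM quote). [VoganZuckerman1984]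
-/

namespace Literature.RepresentationTheory.BergeronMillsonMoeglin2016

universe u

/-- Dictionary for BMM §3.2, `G = U(V) ≅ U(p,q)`, `K ≅ U(p) × U(q)`:
* `Mod` — irreducible admissible representations of `G` up to equivalence; `unitary V`;
  `centralTrivial V`, `infCharTrivial V` ("trivial central character", "the same infinitesimal
  character as the trivial representation");
* `Par` — the `θ`-stable parabolic subalgebras `𝔮 = 𝔮(X) = 𝔩 ⊕ 𝔲`, `X ∈ i𝔱₀`; `R 𝔮 = dim(𝔲 ∩ 𝔭)`;
  `upCls 𝔮` — the datum `𝔲 ∩ 𝔭` (an element of an index type `UP`), on which `A_𝔮` only depends;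
* `KType` — irreducible representations of `K`; `VZtype 𝔮 = V(𝔮) ⊂ ∧^R 𝔭`; `kmult V τ` —
  `dim Hom_K(τ, V)`;
* `A 𝔮` — the representation `A_𝔮`; `hdim V k` — `dim H^k(𝔤, K; V)`; `hL 𝔮 j` — the dimension of
  the printed right-hand side `Hom_{L∩K}(∧^j(…), ℂ)` in degree `j`.
[cite: BergeronMillsonMoeglin2016Balls, §3.1–3.2 pp. 13–14] -/
structure UpqCohomological where
  /-- irreducible admissible representations of `U(p,q)` up to equivalence -/
  Mod : Type u
  /-- `V` is unitary (arXiv draft: "essentially unitary") -/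
  unitary : Mod → Prop
  /-- trivial central character -/
  centralTrivial : Mod → Prop
  /-- infinitesimal character of the trivial representation -/
  infCharTrivial : Mod → Prop
  /-- `θ`-stable parabolics `𝔮(X)` -/
  Par : Type u
  /-- index type for the subspaces `𝔲 ∩ 𝔭` -/
  UP : Type u
  /-- `𝔮 ↦ 𝔲 ∩ 𝔭` -/
  upCls : Par → UP
  /-- `R = dim(𝔲 ∩ 𝔭)` -/
  R : Par → ℕ
  /-- irreducible `K`-types -/
  KType : Type u
  /-- `V(𝔮)` -/
  VZtype : Par → KType
  /-- `dim Hom_K(τ, V)` -/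
  kmult : Mod → KType → ℕ
  /-- `A_𝔮` -/
  A : Par → Mod
  /-- `dim H^k(𝔤, K; V)` -/
  hdim : Mod → ℕ → ℕ
  /-- `dim Hom_{L∩K}(∧^j(…), ℂ)` -/
  hL : Par → ℕ → ℕ

namespace UpqCohomological

/-- **The `A_𝔮` of `U(p,q)`** — BMM §3.2 with display (3.1), transcribed: every `A_𝔮` is unitary
with trivial central and infinitesimal character and contains `V(𝔮)` exactly once; any `V` with
these three properties containing `V(𝔮)` equals `A_𝔮` ("uniquely characterized"); `A_𝔮 = A_𝔮'`
when `𝔲 ∩ 𝔭 = 𝔲' ∩ 𝔭'`; `dim H^k(𝔤,K;A_𝔮) = hL 𝔮 (k − R)` for `k ≥ R` and `0` for `k < R`.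
[cite: BergeronMillsonMoeglin2016Balls, §3.2 pp. 13–14, (3.1)] -/
def Aq_characterisation (B : UpqCohomological.{u}) : Prop :=
  (∀ 𝔮 : B.Par, B.unitary (B.A 𝔮) ∧ B.centralTrivial (B.A 𝔮) ∧ B.infCharTrivial (B.A 𝔮) ∧
    B.kmult (B.A 𝔮) (B.VZtype 𝔮) = 1) ∧
  (∀ (𝔮 : B.Par) (V : B.Mod), B.unitary V → B.centralTrivial V → B.infCharTrivial V →
    B.kmult V (B.VZtype 𝔮) ≠ 0 → V = B.A 𝔮) ∧
  (∀ 𝔮 𝔮' : B.Par, B.upCls 𝔮 = B.upCls 𝔮' → B.A 𝔮 = B.A 𝔮') ∧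
  (∀ (𝔮 : B.Par) (k : ℕ),
    (B.R 𝔮 ≤ k → B.hdim (B.A 𝔮) k = B.hL 𝔮 (k - B.R 𝔮)) ∧ (k < B.R 𝔮 → B.hdim (B.A 𝔮) k = 0))

variable (B : UpqCohomological.{u})

/-- Two `θ`-stable parabolics whose `A_𝔮` share the `K`-type `V(𝔮)` give the same `A_𝔮`
(uniqueness clause applied to `A_𝔮'`). [cite: BergeronMillsonMoeglin2016Balls, §3.2 (3.1)] -/
theorem A_eq_of_kmult_VZtype_ne_zero (h : B.Aq_characterisation) {𝔮 𝔮' : B.Par}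
    (hk : B.kmult (B.A 𝔮') (B.VZtype 𝔮) ≠ 0) : B.A 𝔮' = B.A 𝔮 := by
  obtain ⟨h1, h2, -, -⟩ := h
  obtain ⟨hu, hc, hi, -⟩ := h1 𝔮'
  exact h2 𝔮 (B.A 𝔮') hu hc hi hk

/-- `A_𝔮` is cohomological, with its first cohomology in degree `R = dim(𝔲 ∩ 𝔭)` whenever the
printed right-hand side is non-zero in degree `0` (it is: `Hom_{L∩K}(∧^0, ℂ) = ℂ`, supplied by the
consumer as `hL 𝔮 0 ≠ 0`). [cite: BergeronMillsonMoeglin2016Balls, §3.2 pp. 13–14] -/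
theorem hdim_R_ne_zero (h : B.Aq_characterisation) (𝔮 : B.Par) (h0 : B.hL 𝔮 0 ≠ 0) :
    B.hdim (B.A 𝔮) (B.R 𝔮) ≠ 0 ∧ ∀ k < B.R 𝔮, B.hdim (B.A 𝔮) k = 0 := by
  obtain ⟨-, -, -, h4⟩ := h
  refine ⟨?_, fun k hk => (h4 𝔮 k).2 hk⟩
  rw [(h4 𝔮 (B.R 𝔮)).1 le_rfl, Nat.sub_self]
  exact h0

end UpqCohomological

end Literature.RepresentationTheory.BergeronMillsonMoeglin2016
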